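import Literature.Analysis.FluidPDE.ClassicalSupStabilityForced
import HarnessLib

/-!
# Sup-norm stability at the level of the Oseen integral equation: two bounded fields satisfying
# the mild identity up to remainders

Analysis/FluidPDE proof file (theorems only; no definitions, no named facts, no `sorry`). It is the
MILD-LEVEL form of the tree's `sup_stability_forced_core` (`ClassicalSupStabilityForced.lean`): the two
fields compared are no longer required to be classical solutions of a forced Navier–Stokes system —
only bounded, jointly measurable fields `u`, `u'` on the closed slab `[0, T] × ℝ³` with continuous
slices which satisfy the Oseen integral identity UP TO REMAINDERS `Φ`, `Φ'`:

  `u(t)  = e^{νtΔ} u(0)  − B^ν_0(u, u)(t)   + Φ(t)`   a.e., `t ∈ (0, T]`,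
  `u'(t) = e^{νtΔ} u'(0) − B^ν_0(u', u')(t) + Φ'(t)`  a.e., `t ∈ (0, T]`.

If `‖u‖ ≤ M`, `‖u'‖ ≤ M'`, `‖u'(0) − u(0)‖ ≤ D` and `‖Φ'(t, x) − Φ(t, x)‖ ≤ F` on the slab, then for all
`t ∈ [0, T]` and every `x`

  `‖u'(t, x) − u(t, x)‖ ≤ 2 (D + F) · exp (36 C₀² (M + M')² t / ν)`,

`C₀ = oseenSliceConst ℝ³` (`sup_stability_mild_core`). For classical forced solutions the remainders
are the heat Duhamel integrals of the forces (`IsClassicalNSSolutionOn.ae_eq_forced_oseenMild`) and one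
recovers `sup_stability_forced_core`; the point of the mild form is that the REFERENCE field may be any
bounded field obeying a perturbed integral identity — e.g. the superposition `v₁ + v₂(· − c)` of two
exact solutions, whose remainder is the cross Duhamel term `−B(v₁, v₂(·−c)) − B(v₂(·−c), v₁)`
(consumer: the superposition door of the cell `ns-blowup`, route `PalasekTowerBreakdown`, crux
`EpisodeBase`, stmt-NavierStokesRegularity-19179). The corollary `sup_stability_mild_classical`
specialises the perturbed field to a classical finite-energy solution forced by a weakly
divergence-free force measured in `L²` (`Φ' = ∫₀ᵗ e^{ν(t−τ)Δ} g'(τ) dτ`,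
`‖Φ'‖ ≤ 4 ν^{-3/4} T^{1/4} sup_τ ‖g'(τ)‖₂`).

Mechanism: verbatim the proof of `sup_stability_forced_core` (Leray 1934, §19 (3.4)–(3.8);
Lemarié-Rieusset 2016, Thm. 6.1 (6.12) + Prop. 6.5: subtract the two identities, split
`B(u',u') − B(u,u) = B(u', w) + B(w, u)`, `w = u' − u`, bound the bilinear terms by the slice estimate
`‖N_σ[a,b]‖ ≤ C₀ σ^{-1/2} ‖a‖_∞ ‖b‖_∞` against the weight `e^{λτ}`, `λ = 36 C₀² (M+M')²/ν`, and close in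
the weighted sup norm — a linear Abel–Volterra inequality, Ożański–Pooley 2018, Lemma 6.5). LABEL:
Literature port (a-priori estimate for GIVEN fields). WHAT THIS IS NOT: not a statement about
Navier–Stokes regularity or blow-up.

## Mathlib / tree search

Tree: `sup_stability_forced_core`, `norm_oseenDuhamel_le_setIntegral_visc`,
`setIntegral_visc_abelKernel_mul_exp_le` (`ClassicalSupStabilityForced`); `oseenDuhamel_sub_left/right`
(`KatoLocalBoundedPicard`); `UnboundedOperators.heatExtension_sub_of_bound`,
`UnboundedOperators.norm_heatExtension_le`; `forall_norm_le_of_ae_norm_le`;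
`IsClassicalNSSolutionOn.ae_eq_forced_oseenMild`, `norm_forceDuhamel_le_of_eLpNorm_two`. No mild-level
(remainder) form of the sup-norm stability estimate existed (`lean search 'stability_mild|mild_core'`).

## References

* J. Leray, *Sur le mouvement d'un liquide visqueux emplissant l'espace*, Acta Math. 63 (1934),
  §19 (3.4)–(3.8). [Leray1934]
* P. G. Lemarié-Rieusset, *The Navier–Stokes Problem in the 21st Century*, CRC Press 2016, Thm. 6.1
  (6.12) with Prop. 6.5, pp. 133–136. [LemarieRieusset2016]
* W. S. Ożański, B. C. Pooley, *Leray's fundamental work on the Navier–Stokes equations*, LMS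
  Lecture Note Ser. 452 (2018), Lemma 6.5. [OzanskiPooley2018]
* G. Koch, N. Nadirashvili, G. Seregin, V. Šverák, Acta Math. 203 (2009), §3 (3.5).
  [KochNadirashviliSereginSverak2009]
-/

noncomputable section

open MeasureTheory Set Function Filter
open _root_.Topology
open scoped ENNReal NNReal

namespace Literature.Analysis.FluidPDE

section MildCore

variable {ν T M M' D F : ℝ}
  {u u' Φ Φ' : ℝ → EuclideanSpace ℝ (Fin 3) → EuclideanSpace ℝ (Fin 3)}

/-- **Sup-norm stability of two bounded fields satisfying the Oseen integral identity up to
remainders (mild core).** Let `u`, `u'` be fields on `[0, T] × ℝ³` (`ν > 0`, `T > 0`) with continuous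
slices, jointly (a.e.-strongly) measurable on the open slab, bounded by `M`, `M'` (`M, M' > 0`), and
satisfying for every `t ∈ (0, T]`, a.e. in `x`,
`u(t) = e^{νtΔ}u(0) − B^ν_0(u,u)(t) + Φ(t)` and `u'(t) = e^{νtΔ}u'(0) − B^ν_0(u',u')(t) + Φ'(t)`.
If `‖u'(0,·) − u(0,·)‖ ≤ D` and `‖Φ'(t,x) − Φ(t,x)‖ ≤ F` (`F ≥ 0`) for `t ∈ (0, T]` and all `x`, then for
all `t ∈ [0, T]` and all `x`: `‖u'(t,x) − u(t,x)‖ ≤ 2 (D + F) exp (36 C₀² (M + M')² t / ν)`,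
`C₀ = oseenSliceConst ℝ³`. [cite: Leray1934, §19 (3.4)–(3.8)]
[cite: LemarieRieusset2016, Thm. 6.1 (6.12) with Prop. 6.5] [cite: OzanskiPooley2018, Lemma 6.5] -/
theorem sup_stability_mild_core (hν : 0 < ν) (hT : 0 < T)
    (hslc : ∀ t ∈ Icc 0 T, Continuous (u t)) (hslc' : ∀ t ∈ Icc 0 T, Continuous (u' t))
    (hmeas : AEStronglyMeasurable (uncurry u)
      ((volume : Measure (ℝ × EuclideanSpace ℝ (Fin 3))).restrict (Ioo 0 T ×ˢ univ)))
    (hmeas' : AEStronglyMeasurable (uncurry u')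
      ((volume : Measure (ℝ × EuclideanSpace ℝ (Fin 3))).restrict (Ioo 0 T ×ˢ univ)))
    (hM : 0 < M) (hM' : 0 < M')
    (hbd : ∀ t ∈ Icc 0 T, ∀ y, ‖u t y‖ ≤ M) (hbd' : ∀ t ∈ Icc 0 T, ∀ y, ‖u' t y‖ ≤ M')
    (hrep : ∀ t ∈ Ioc 0 T, u t =ᵐ[volume] fun x =>
      UnboundedOperators.heatExtension (u 0) (ν * t) x - oseenDuhamel ν 0 u u t x + Φ t x)
    (hrep' : ∀ t ∈ Ioc 0 T, u' t =ᵐ[volume] fun x =>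
      UnboundedOperators.heatExtension (u' 0) (ν * t) x - oseenDuhamel ν 0 u' u' t x + Φ' t x)
    (hD : ∀ y, ‖u' 0 y - u 0 y‖ ≤ D) (hF0 : 0 ≤ F)
    (hF : ∀ t ∈ Ioc 0 T, ∀ x, ‖Φ' t x - Φ t x‖ ≤ F) :
    ∀ t ∈ Icc 0 T, ∀ x, ‖u' t x - u t x‖ ≤
      2 * (D + F) * Real.exp (36 * oseenSliceConst (EuclideanSpace ℝ (Fin 3)) ^ 2 * (M + M') ^ 2 / ν * t) := by
  -- ### constants
  set C₀ : ℝ := oseenSliceConst (EuclideanSpace ℝ (Fin 3)) with hC₀def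
  have hC₀ : 0 < C₀ := oseenSliceConst_pos
  set lam : ℝ := 36 * C₀ ^ 2 * (M + M') ^ 2 / ν with hlam_def
  have hMM : 0 < M + M' := add_pos hM hM'
  have hlam : 0 < lam := by positivity
  have hD0 : 0 ≤ D := (norm_nonneg _).trans (hD 0)
  -- the key algebraic identity behind the choice of `λ`: `3 C₀ (M+M') (νλ)^{-1/2} = 1/2`
  have hkey : C₀ * (ν ^ (-(1 / 2 : ℝ)) * (3 * lam ^ (-(1 / 2 : ℝ)))) * (M + M') = 1 / 2 := by
    have hνl : ν * lam = (6 * C₀ * (M + M')) ^ 2 := by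
      rw [hlam_def]; field_simp; ring
    have h1 : ν ^ (-(1 / 2 : ℝ)) * lam ^ (-(1 / 2 : ℝ)) = (6 * C₀ * (M + M'))⁻¹ := by
      rw [← Real.mul_rpow hν.le hlam.le, hνl, Real.rpow_neg (sq_nonneg _),
        show ((6 * C₀ * (M + M')) ^ 2) ^ (1 / 2 : ℝ) = 6 * C₀ * (M + M') by
          rw [← Real.sqrt_eq_rpow, Real.sqrt_sq (by positivity)]]
    calc C₀ * (ν ^ (-(1 / 2 : ℝ)) * (3 * lam ^ (-(1 / 2 : ℝ)))) * (M + M')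
        = 3 * C₀ * (M + M') * (ν ^ (-(1 / 2 : ℝ)) * lam ^ (-(1 / 2 : ℝ))) := by ring
      _ = 3 * C₀ * (M + M') * (6 * C₀ * (M + M'))⁻¹ := by rw [h1]
      _ = 1 / 2 := by field_simp; ring
  -- ### the difference field and the weighted supremum
  set w : ℝ → EuclideanSpace ℝ (Fin 3) → EuclideanSpace ℝ (Fin 3) := fun τ y => u' τ y - u τ y
    with hw_def
  have hwbd : ∀ τ ∈ Icc 0 T, ∀ y, ‖w τ y‖ ≤ M' + M := fun τ hτ y =>
    (norm_sub_le _ _).trans (add_le_add (hbd' τ hτ y) (hbd τ hτ y))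
  set S : Set ℝ := {r | ∃ τ ∈ Icc 0 T, ∃ y : EuclideanSpace ℝ (Fin 3),
    r = Real.exp (-(lam * τ)) * ‖w τ y‖} with hS_def
  have hSbdd : BddAbove S := by
    refine ⟨M' + M, ?_⟩
    rintro r ⟨τ, hτ, y, rfl⟩
    have he : Real.exp (-(lam * τ)) ≤ 1 := by
      rw [Real.exp_le_one_iff]; nlinarith [hτ.1]
    calc Real.exp (-(lam * τ)) * ‖w τ y‖ ≤ 1 * (M' + M) :=
          mul_le_mul he (hwbd τ hτ y) (norm_nonneg _) zero_le_one
      _ = M' + M := one_mul _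
  have h0I : (0 : ℝ) ∈ Icc 0 T := ⟨le_rfl, hT.le⟩
  have hSne : S.Nonempty := ⟨_, 0, h0I, 0, rfl⟩
  set A : ℝ := sSup S with hA_def
  have hA0 : 0 ≤ A := by
    have hmem : Real.exp (-(lam * 0)) * ‖w 0 0‖ ∈ S := ⟨0, h0I, 0, rfl⟩
    exact le_trans (mul_nonneg (Real.exp_pos _).le (norm_nonneg _)) (le_csSup hSbdd hmem)
  have hwA : ∀ τ ∈ Icc 0 T, ∀ y, ‖w τ y‖ ≤ A * Real.exp (lam * τ) := by
    intro τ hτ y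
    have hmem : Real.exp (-(lam * τ)) * ‖w τ y‖ ∈ S := ⟨τ, hτ, y, rfl⟩
    have h1 : Real.exp (-(lam * τ)) * ‖w τ y‖ ≤ A := le_csSup hSbdd hmem
    have h2 := mul_le_mul_of_nonneg_right h1 (Real.exp_pos (lam * τ)).le
    rwa [mul_assoc, mul_comm ‖w τ y‖, ← mul_assoc, ← Real.exp_add, neg_add_cancel, Real.exp_zero,
      one_mul] at h2
  -- ### slab bounds on the open slab
  have hmeasw : AEStronglyMeasurable (uncurry w)
      ((volume : Measure (ℝ × EuclideanSpace ℝ (Fin 3))).restrict (Ioo 0 T ×ˢ univ)) :=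
    hmeas'.sub hmeas
  have hbdo : ∀ τ ∈ Ioo 0 T, ∀ y, ‖u τ y‖ ≤ M := fun τ hτ => hbd τ ⟨hτ.1.le, hτ.2.le⟩
  have hbdo' : ∀ τ ∈ Ioo 0 T, ∀ y, ‖u' τ y‖ ≤ M' := fun τ hτ => hbd' τ ⟨hτ.1.le, hτ.2.le⟩
  have hwbdo : ∀ τ ∈ Ioo 0 T, ∀ y, ‖w τ y‖ ≤ M' + M := fun τ hτ => hwbd τ ⟨hτ.1.le, hτ.2.le⟩
  -- ### the pointwise estimate at every `(t, x)` of the slab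
  have hpt : ∀ t ∈ Icc 0 T, ∀ x, Real.exp (-(lam * t)) * ‖w t x‖ ≤ (D + F) + A / 2 := by
    intro t ht x
    rcases ht.1.eq_or_lt with h0 | ht0
    · -- `t = 0`
      rw [← h0, mul_zero, neg_zero, Real.exp_zero, one_mul]
      calc ‖w 0 x‖ ≤ D := hD x
        _ ≤ (D + F) + A / 2 := by linarith
    have htI : t ∈ Ioc 0 T := ⟨ht0, ht.2⟩
    -- the two representations at time `t`
    have hrept := hrep t htI
    have hrept' := hrep' t htI
    -- the bilinear terms
    have hνt : 0 < ν * t := mul_pos hν ht0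
    have hBsplit : ∀ y, oseenDuhamel ν 0 u' u' t y - oseenDuhamel ν 0 u u t y =
        oseenDuhamel ν 0 u' w t y + oseenDuhamel ν 0 w u t y := by
      intro y
      have h1 := oseenDuhamel_sub_right hν hmeas' hmeas' hmeas hbdo' hbdo' hbdo ht0 ht.2 y
      have h2 := oseenDuhamel_sub_left hν hmeas' hmeas hmeas hbdo' hbdo hbdo ht0 ht.2 y
      change oseenDuhamel ν 0 u' w t y = _ at h1
      change oseenDuhamel ν 0 w u t y = _ at h2
      rw [h1, h2]; abel
    obtain ⟨hIw, hIle⟩ := setIntegral_visc_abelKernel_mul_exp_le (K := A) hν hlam ht.1 hA0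
    have hwAo : ∀ τ ∈ Ioo 0 t, ∀ y, ‖w τ y‖ ≤ A * Real.exp (lam * τ) := fun τ hτ =>
      hwA τ ⟨hτ.1.le, hτ.2.le.trans ht.2⟩
    have hB1 : ∀ y, ‖oseenDuhamel ν 0 u' w t y‖ ≤
        C₀ * (M' * (A * ν ^ (-(1 / 2 : ℝ)) * (3 * lam ^ (-(1 / 2 : ℝ)) * Real.exp (lam * t)))) := by
      intro y
      have hint : IntegrableOn
          (fun τ => (ν * (t - τ)) ^ (-(1 / 2 : ℝ)) * (M' * (A * Real.exp (lam * τ)))) (Ioo 0 t) := by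
        have := hIw.const_mul M'
        exact IntegrableOn.congr_fun this (fun τ _ => by ring) measurableSet_Ioo
      refine (norm_oseenDuhamel_le_setIntegral_visc hν
        (fun τ hτ => hbdo' τ ⟨hτ.1, hτ.2.trans_le ht.2⟩) hwAo hint y).trans ?_
      have heq : ∫ τ in Ioo 0 t, (ν * (t - τ)) ^ (-(1 / 2 : ℝ)) * (M' * (A * Real.exp (lam * τ))) =
          M' * ∫ τ in Ioo 0 t, (ν * (t - τ)) ^ (-(1 / 2 : ℝ)) * (A * Real.exp (lam * τ)) := by
        rw [← integral_const_mul]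
        refine setIntegral_congr_fun measurableSet_Ioo fun τ _ => by ring
      rw [heq]
      exact mul_le_mul_of_nonneg_left (mul_le_mul_of_nonneg_left hIle hM'.le) hC₀.le
    have hB2 : ∀ y, ‖oseenDuhamel ν 0 w u t y‖ ≤
        C₀ * ((A * ν ^ (-(1 / 2 : ℝ)) * (3 * lam ^ (-(1 / 2 : ℝ)) * Real.exp (lam * t))) * M) := by
      intro y
      have hint : IntegrableOn
          (fun τ => (ν * (t - τ)) ^ (-(1 / 2 : ℝ)) * ((A * Real.exp (lam * τ)) * M)) (Ioo 0 t) := by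
        have := hIw.mul_const M
        exact IntegrableOn.congr_fun this (fun τ _ => by ring) measurableSet_Ioo
      refine (norm_oseenDuhamel_le_setIntegral_visc hν hwAo
        (fun τ hτ => hbdo τ ⟨hτ.1, hτ.2.trans_le ht.2⟩) hint y).trans ?_
      have heq : ∫ τ in Ioo 0 t, (ν * (t - τ)) ^ (-(1 / 2 : ℝ)) * ((A * Real.exp (lam * τ)) * M) =
          (∫ τ in Ioo 0 t, (ν * (t - τ)) ^ (-(1 / 2 : ℝ)) * (A * Real.exp (lam * τ))) * M := by
        rw [← integral_mul_const]
        refine setIntegral_congr_fun measurableSet_Ioo fun τ _ => by ring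
      rw [heq]
      exact mul_le_mul_of_nonneg_left (mul_le_mul_of_nonneg_right hIle hM.le) hC₀.le
    -- the heat term
    have hH : ∀ y, ‖UnboundedOperators.heatExtension (u' 0) (ν * t) y -
        UnboundedOperators.heatExtension (u 0) (ν * t) y‖ ≤ D := by
      intro y
      rw [← UnboundedOperators.heatExtension_sub_of_bound (hslc' 0 h0I) (hslc 0 h0I) (hbd' 0 h0I)
        (hbd 0 h0I) hνt y]
      exact UnboundedOperators.norm_heatExtension_le hD hνt y
    -- assemble, a.e. in `x`
    have hbound : (D + F) + A / 2 * Real.exp (lam * t) =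
        D + (C₀ * (M' * (A * ν ^ (-(1 / 2 : ℝ)) * (3 * lam ^ (-(1 / 2 : ℝ)) * Real.exp (lam * t)))) +
          C₀ * ((A * ν ^ (-(1 / 2 : ℝ)) * (3 * lam ^ (-(1 / 2 : ℝ)) * Real.exp (lam * t))) * M)) + F := by
      have : C₀ * (M' * (A * ν ^ (-(1 / 2 : ℝ)) * (3 * lam ^ (-(1 / 2 : ℝ)) * Real.exp (lam * t)))) +
          C₀ * ((A * ν ^ (-(1 / 2 : ℝ)) * (3 * lam ^ (-(1 / 2 : ℝ)) * Real.exp (lam * t))) * M) =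
          (C₀ * (ν ^ (-(1 / 2 : ℝ)) * (3 * lam ^ (-(1 / 2 : ℝ)))) * (M + M')) * A * Real.exp (lam * t) := by
        ring
      rw [this, hkey]; ring
    have hae : ∀ᵐ y ∂(volume : Measure (EuclideanSpace ℝ (Fin 3))),
        ‖w t y‖ ≤ (D + F) + A / 2 * Real.exp (lam * t) := by
      filter_upwards [hrept, hrept'] with y hy hy'
      have hwy : w t y = (UnboundedOperators.heatExtension (u' 0) (ν * t) y -
            UnboundedOperators.heatExtension (u 0) (ν * t) y) -
          (oseenDuhamel ν 0 u' u' t y - oseenDuhamel ν 0 u u t y) +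
          (Φ' t y - Φ t y) := by
        show u' t y - u t y = _
        rw [hy, hy']; abel
      rw [hwy, hBsplit y, hbound]
      calc ‖UnboundedOperators.heatExtension (u' 0) (ν * t) y -
              UnboundedOperators.heatExtension (u 0) (ν * t) y -
            (oseenDuhamel ν 0 u' w t y + oseenDuhamel ν 0 w u t y) + (Φ' t y - Φ t y)‖
          ≤ ‖UnboundedOperators.heatExtension (u' 0) (ν * t) y -
              UnboundedOperators.heatExtension (u 0) (ν * t) y -
            (oseenDuhamel ν 0 u' w t y + oseenDuhamel ν 0 w u t y)‖ + ‖Φ' t y - Φ t y‖ :=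
            norm_add_le _ _
        _ ≤ (‖UnboundedOperators.heatExtension (u' 0) (ν * t) y -
              UnboundedOperators.heatExtension (u 0) (ν * t) y‖ +
            ‖oseenDuhamel ν 0 u' w t y + oseenDuhamel ν 0 w u t y‖) + ‖Φ' t y - Φ t y‖ := by
            gcongr; exact norm_sub_le _ _
        _ ≤ (D + (‖oseenDuhamel ν 0 u' w t y‖ + ‖oseenDuhamel ν 0 w u t y‖)) + F := by
            gcongr
            · exact hH y
            · exact norm_add_le _ _
            · exact hF t htI y
        _ ≤ (D + (C₀ * (M' * (A * ν ^ (-(1 / 2 : ℝ)) * (3 * lam ^ (-(1 / 2 : ℝ)) * Real.exp (lam * t)))) +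
            C₀ * ((A * ν ^ (-(1 / 2 : ℝ)) * (3 * lam ^ (-(1 / 2 : ℝ)) * Real.exp (lam * t))) * M))) + F := by
            gcongr
            · exact hB1 y
            · exact hB2 y
    have hev : ‖w t x‖ ≤ (D + F) + A / 2 * Real.exp (lam * t) :=
      forall_norm_le_of_ae_norm_le (f := w t) ((hslc' t ht).sub (hslc t ht)) hae x
    -- multiply by the weight
    have hexp : 0 < Real.exp (-(lam * t)) := Real.exp_pos _
    have hexp1 : Real.exp (-(lam * t)) ≤ 1 := by
      rw [Real.exp_le_one_iff]; nlinarith [ht.1]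
    calc Real.exp (-(lam * t)) * ‖w t x‖
        ≤ Real.exp (-(lam * t)) * ((D + F) + A / 2 * Real.exp (lam * t)) :=
          mul_le_mul_of_nonneg_left hev hexp.le
      _ = Real.exp (-(lam * t)) * (D + F) + A / 2 * (Real.exp (-(lam * t)) * Real.exp (lam * t)) := by
          ring
      _ = Real.exp (-(lam * t)) * (D + F) + A / 2 := by
          rw [← Real.exp_add, neg_add_cancel, Real.exp_zero, mul_one]
      _ ≤ 1 * (D + F) + A / 2 := by gcongr
      _ = (D + F) + A / 2 := by rw [one_mul]
  -- ### the weighted supremum is at most `2 (D + F)`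
  have hAle : A ≤ (D + F) + A / 2 := by
    refine csSup_le hSne ?_
    rintro r ⟨τ, hτ, y, rfl⟩
    exact hpt τ hτ y
  have hA2 : A ≤ 2 * (D + F) := by linarith
  -- ### conclusion
  intro t ht x
  have h1 := hwA t ht x
  have hlam_t : lam * t = 36 * C₀ ^ 2 * (M + M') ^ 2 / ν * t := by rw [hlam_def]
  calc ‖u' t x - u t x‖ = ‖w t x‖ := rfl
    _ ≤ A * Real.exp (lam * t) := h1
    _ ≤ 2 * (D + F) * Real.exp (lam * t) :=
        mul_le_mul_of_nonneg_right hA2 (Real.exp_pos _).le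
    _ = _ := by rw [hlam_t]

end MildCore

/-! ### The perturbed field a classical forced solution: the remainder is the force integral -/

section MildClassical

variable {ν T M M' D F : ℝ}
  {u Φ g' u' : ℝ → EuclideanSpace ℝ (Fin 3) → EuclideanSpace ℝ (Fin 3)}
  {p' : ℝ → EuclideanSpace ℝ (Fin 3) → ℝ} {G' G₂r : ℝ}

/-- **Mild-level stability, the perturbed field a classical forced solution.** Let `u` be a bounded
(`‖u‖ ≤ M`, `M > 0`) field on `[0, T] × ℝ³` with continuous slices, jointly measurable on the open
slab, obeying `u(t) = e^{νtΔ}u(0) − B^ν_0(u,u)(t) + Φ(t)` a.e. for `t ∈ (0, T]` with `‖Φ(t,x)‖ ≤ F`;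
let `(u', p')` be a classical solution on `[0, T] × ℝ³` forced by `g'` (jointly continuous, bounded,
weakly divergence-free slices, `‖g'(τ)‖₂ ≤ G₂'`) with finite energy and `‖u'‖ ≤ M'` (`M' > 0`), and
`‖u'(0,·) − u(0,·)‖ ≤ D`. Then for all `t ∈ [0, T]` and all `x`:
`‖u'(t,x) − u(t,x)‖ ≤ 2 (D + (F + 4 ν^{-3/4} T^{1/4} G₂')) exp (36 C₀² (M + M')² t / ν)`.
[cite: Leray1934, §19 (3.4)–(3.8)] [cite: LemarieRieusset2016, Thm. 6.1 (6.12) with Prop. 6.5] -/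
theorem sup_stability_mild_classical (hν : 0 < ν) (hT : 0 < T)
    (hslc : ∀ t ∈ Icc 0 T, Continuous (u t))
    (hmeas : AEStronglyMeasurable (uncurry u)
      ((volume : Measure (ℝ × EuclideanSpace ℝ (Fin 3))).restrict (Ioo 0 T ×ˢ univ)))
    (hM : 0 < M) (hbd : ∀ t ∈ Icc 0 T, ∀ y, ‖u t y‖ ≤ M)
    (hrep : ∀ t ∈ Ioc 0 T, u t =ᵐ[volume] fun x =>
      UnboundedOperators.heatExtension (u 0) (ν * t) x - oseenDuhamel ν 0 u u t x + Φ t x)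
    (hF0 : 0 ≤ F) (hF : ∀ t ∈ Ioc 0 T, ∀ x, ‖Φ t x‖ ≤ F)
    (hcl' : IsClassicalNSSolutionOn (Icc 0 T) ν g' u' p')
    (hg'c : Continuous (uncurry g'))
    (hG' : ∀ τ ∈ Icc 0 T, ∀ y, ‖g' τ y‖ ≤ G')
    (hg'div : ∀ τ ∈ Icc 0 T, IsWeaklyDivFree (g' τ)) (hG₂r : 0 ≤ G₂r)
    (hg'2 : ∀ τ ∈ Icc 0 T, eLpNorm (g' τ) 2 volume ≤ ENNReal.ofReal G₂r)
    (hE' : ∃ C : ℝ≥0∞, C < ⊤ ∧ ∀ t ∈ Icc 0 T, ∫⁻ x, ‖u' t x‖ₑ ^ 2 ≤ C)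
    (hM' : 0 < M') (hbd' : ∀ t ∈ Icc 0 T, ∀ y, ‖u' t y‖ ≤ M')
    (hD : ∀ y, ‖u' 0 y - u 0 y‖ ≤ D) :
    ∀ t ∈ Icc 0 T, ∀ x, ‖u' t x - u t x‖ ≤
      2 * (D + (F + 4 * ν ^ (-(3 / 4 : ℝ)) * T ^ (1 / 4 : ℝ) * G₂r)) *
        Real.exp (36 * oseenSliceConst (EuclideanSpace ℝ (Fin 3)) ^ 2 * (M + M') ^ 2 / ν * t) := by
  have hslc' : ∀ t ∈ Icc 0 T, Continuous (u' t) := fun t ht => (hcl'.contDiff_velocity ht).continuous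
  have hmeas' : AEStronglyMeasurable (uncurry u')
      ((volume : Measure (ℝ × EuclideanSpace ℝ (Fin 3))).restrict (Ioo 0 T ×ˢ univ)) :=
    (hcl'.smooth_velocity.continuousOn.mono (prod_mono Ioo_subset_Icc_self Subset.rfl)).aestronglyMeasurable
      (measurableSet_Ioo.prod MeasurableSet.univ)
  have hg'slc : ∀ τ, Continuous (g' τ) := fun τ => hg'c.comp (continuous_const.prodMk continuous_id)
  have hg'mem : ∀ τ ∈ Icc 0 T, MemLp (g' τ) 2 volume := fun τ hτ =>
    ⟨(hg'slc τ).aestronglyMeasurable, (hg'2 τ hτ).trans_lt ENNReal.ofReal_lt_top⟩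
  have hrep' : ∀ t ∈ Ioc 0 T, u' t =ᵐ[volume] fun x =>
      UnboundedOperators.heatExtension (u' 0) (ν * t) x - oseenDuhamel ν 0 u' u' t x +
        forceDuhamel ν 0 g' t x := fun t ht =>
    hcl'.ae_eq_forced_oseenMild hν hT hg'c hG' hg'div ENNReal.ofReal_ne_top hg'2 hE' hM' hbd' ht
  have hFν : 0 ≤ 4 * ν ^ (-(3 / 4 : ℝ)) * T ^ (1 / 4 : ℝ) * G₂r := by positivity
  refine sup_stability_mild_core hν hT hslc hslc' hmeas hmeas' hM hM' hbd hbd' hrep hrep' hD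
    (add_nonneg hF0 hFν) ?_
  intro t ht x
  have hforce : ‖forceDuhamel ν 0 g' t x‖ ≤ 4 * ν ^ (-(3 / 4 : ℝ)) * T ^ (1 / 4 : ℝ) * G₂r := by
    refine (norm_forceDuhamel_le_of_eLpNorm_two hν ht.1 hG₂r
      (fun τ hτ => hg'mem τ ⟨hτ.1.le, hτ.2.le.trans ht.2⟩)
      (fun τ hτ => hg'2 τ ⟨hτ.1.le, hτ.2.le.trans ht.2⟩) x).trans ?_
    have ht4 : t ^ (1 / 4 : ℝ) ≤ T ^ (1 / 4 : ℝ) := Real.rpow_le_rpow ht.1.le ht.2 (by norm_num)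
    have hν34 : 0 ≤ 4 * ν ^ (-(3 / 4 : ℝ)) := by positivity
    gcongr
  calc ‖forceDuhamel ν 0 g' t x - Φ t x‖ ≤ ‖forceDuhamel ν 0 g' t x‖ + ‖Φ t x‖ := norm_sub_le _ _
    _ ≤ 4 * ν ^ (-(3 / 4 : ℝ)) * T ^ (1 / 4 : ℝ) * G₂r + F := add_le_add hforce (hF t ht x)
    _ = F + 4 * ν ^ (-(3 / 4 : ℝ)) * T ^ (1 / 4 : ℝ) * G₂r := add_comm _ _

end MildClassical

end Literature.Analysis.FluidPDE

end
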